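import Summits.ValiantsHypothesis.ValiantsHypothesis.Theorems.LacunarySymmetroidMatrixDescartesDoorA26WallBubblingMixedEndgame

/-!
# `DoorA26` / line `wall_bubbling` — MIXED NO-BALANCE: with rank-zero nodes present, no RESTRICTED balance exists

HONEST FRAMING.  Object-search cell `pub-symmetroid`, crux `Theses.LacunarySymmetroid.DoorA26` (stmt-ValiantsHypothesis-19979; OPEN, typed,
never asserted).  W2 seat val-sym-door-p1 g19; def-free helper for obligation (R) of `Cruxes/DoorA26/Lines/wall_bubbling.lean`.  File #61 of
the MIXED chain #58–#63.  Imports #60 `…MixedEndgame`.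

WHAT IS HERE.  ★★ `noRestrictedBalance`: honest encoding of the touch set `J` (`0, 20 ∉ J`, no two adjacent indices); nodes `J₀ ⊆ J` where the pencil
VANISHES (rank-zero double zeros); rank-one touches on `J ∖ J₀` (`det = 0 ≠ tr`); `0 < κ_j det P(τ_j)` off `J`; weights `μ ≥ 0` supported on `J ∖ J₀`;
RESTRICTED BALANCE (test form): for every six-term sum `φ` vanishing at the node abscissae and every test matrix `β`,
`Σ_j μ_jκ_j polar(β,P(τ_j)) φ(τ_j) = 0`.  Then `μ = 0`.  This is exactly the Gordan obstruction to solving the first-order pushes at the rank-one touches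
by a shift pencil VANISHING at the nodes (#62).  Proof = #55 with the nodes counted as zeros of every test function: the support bounds drop by `|J₀|`
(#58 `eq_zero_of_pairing_small`), #53 `false_of_parallel_touches` absorbs the nodes as `0 • p`, the endgame is #60.  Nothing here bears on `DoorA26`, `DoorA34`, (W)/(M)/(R) as typed, `MatrixDescartes` (18050) or `VP ≠ VNP`; registers unchanged.

[this work].
-/

set_option linter.dupNamespace false

namespace Summit.ValiantsHypothesis.ValiantsHypothesis.Theorems.LacunarySymmetroidMatrixDescartes.WallBubbling

open Finset Filter Topology
open Bubbling (polar polar_apply polar_comm polar_self expSum)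

/-- **NO RESTRICTED BALANCE (rank-one touches AND rank-zero nodes).**  Honest encoding of the touch set `J` (`0, 20 ∉ J`, no two adjacent
indices); nodes `J₀ ⊆ J` where the pencil VANISHES; on `J ∖ J₀` rank-one touches (`det = 0 ≠ tr`); off `J` the signs `0 < κ_j det P(τ_j)`.
Weights `μ ≥ 0` supported on `J ∖ J₀`.  RESTRICTED BALANCE hypothesis (test form): for every six-term sum `φ` vanishing at the node
abscissae and every test matrix `β`, `Σ_j μ_j κ_j φ(τ_j) polar(β, P(τ_j)) = 0`.  Then `μ = 0`.  (Proof = #55 `noBalance_of_rankOne` with the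
nodes counted as zeros of every test function: support bounds drop by `|J₀|`, the parallel-touch lemma absorbs the nodes as `0 • p`, and the
endgame is `false_of_short_restricted`.) [this work] -/
theorem noRestrictedBalance (δ : Fin 6 → ℝ) (hd : StrictMono δ) (S : Fin 6 → Matrix (Fin 2) (Fin 2) ℝ)
    (hS : ∀ l, (S l).IsSymm) (τ : Fin 21 → ℝ) (hτ : StrictMono τ) (κ : Fin 21 → ℝ) (J J₀ : Finset (Fin 21)) (hJ₀ : J₀ ⊆ J)
    (hoff : ∀ j ∉ J, 0 < κ j * (∑ l, Real.exp (δ l * τ j) • S l).det)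
    (hon : ∀ j ∈ J, j ∉ J₀ → (∑ l, Real.exp (δ l * τ j) • S l).det = 0 ∧ (∑ l, Real.exp (δ l * τ j) • S l).trace ≠ 0)
    (hnode : ∀ i ∈ J₀, (∑ l, Real.exp (δ l * τ i) • S l) = 0)
    (halt : ∀ j : Fin 20, κ j.castSucc * κ j.succ < 0)
    (h0 : (0 : Fin 21) ∉ J) (h20 : Fin.last 20 ∉ J) (hsep : ∀ j : Fin 20, j.castSucc ∈ J → j.succ ∉ J)
    (μ : Fin 21 → ℝ) (hμ0 : ∀ j, 0 ≤ μ j) (hμJ : ∀ j ∉ J, μ j = 0) (hμN : ∀ j ∈ J₀, μ j = 0)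
    (hbal : ∀ c : Fin 6 → ℝ, (∀ i ∈ J₀, ∑ l, c l * Real.exp (δ l * τ i) = 0) → ∀ β : Matrix (Fin 2) (Fin 2) ℝ,
      ∑ j, (μ j * κ j * polar β (∑ l', Real.exp (δ l' * τ j) • S l')) * (∑ l, c l * Real.exp (δ l * τ j)) = 0) :
    ∀ j, μ j = 0 := by
  classical
  set P : Fin 21 → Matrix (Fin 2) (Fin 2) ℝ := fun j => ∑ l', Real.exp (δ l' * τ j) • S l' with hP
  have hPsym : ∀ j, (P j) 1 0 = (P j) 0 1 := fun j => (isSymm_expPencil δ S hS (τ j)).apply 0 1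
  have hκ : ∀ j, κ j ≠ 0 := by
    intro j hz
    rcases Fin.eq_castSucc_or_eq_last j with ⟨m, hm⟩ | hlast
    · have := halt m; rw [← hm, hz, zero_mul] at this; exact lt_irrefl _ this
    · have := halt (Fin.last 19); rw [Fin.succ_last, ← hlast, hz, mul_zero] at this; exact lt_irrefl _ this
  have hdet0 : (P 0).det ≠ 0 := by
    intro hz; have := hoff 0 h0; rw [show (∑ l, Real.exp (δ l * τ 0) • S l).det = (P 0).det from rfl, hz,
      mul_zero] at this; exact lt_irrefl _ this
  by_contra hne
  push Not at hne
  -- support of `μ`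
  set J' : Finset (Fin 21) := Finset.univ.filter fun j => μ j ≠ 0 with hJ'
  have hmemJ' : ∀ j, j ∈ J' ↔ μ j ≠ 0 := fun j => by simp [hJ']
  have hJ'J : ∀ j ∈ J', j ∈ J ∧ j ∉ J₀ := fun j hj =>
    ⟨by_contra fun h => (hmemJ' j).1 hj (hμJ j h), fun h => (hmemJ' j).1 hj (hμN j h)⟩
  have hJ'ne : J'.Nonempty := by obtain ⟨j, hj⟩ := hne; exact ⟨j, (hmemJ' j).2 hj⟩
  have hJ'N : Disjoint J' J₀ := Finset.disjoint_left.2 fun j hj h => (hJ'J j hj).2 h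
  -- restricted orthogonality of the test vectors
  have hker : ∀ (β : Matrix (Fin 2) (Fin 2) ℝ) (c : Fin 6 → ℝ), (∀ i ∈ J₀, ∑ l, c l * Real.exp (δ l * τ i) = 0) →
      ∑ j, (μ j * κ j * polar β (P j)) * (∑ l, c l * Real.exp (δ l * τ j)) = 0 := fun β c hc => hbal c hc β
  -- `|J'| + |J₀| ≥ 7` by the trace test
  have h7 : 7 ≤ J'.card + J₀.card := by
    by_contra hlt
    have hz := eq_zero_of_pairing_small δ hd τ hτ J' J₀ hJ'N (by omega) (fun j => μ j * κ j * polar 1 (P j))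
      (fun j hj => by rw [not_not.1 fun h => hj ((hmemJ' j).2 h)]; ring) (hker 1)
    obtain ⟨j, hj⟩ := hJ'ne
    have := hz j
    rw [polar_one_left] at this
    rcases mul_eq_zero.1 this with h | h
    · rcases mul_eq_zero.1 h with h' | h'
      · exact (hmemJ' j).1 hj h'
      · exact hκ j h'
    · exact (hon j (hJ'J j hj).1 (hJ'J j hj).2).2 (by linarith)
  -- the last touch of the support
  set k := J'.max' hJ'ne with hk
  have hkJ' : k ∈ J' := Finset.max'_mem _ _
  have hle_k : ∀ j ∈ J', j ≤ k := fun j hj => Finset.le_max' _ j hj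
  obtain ⟨hkdet, hktr⟩ := hon k (hJ'J k hkJ').1 (hJ'J k hkJ').2
  have hpar : ∀ j ∈ J, j ∉ J₀ → polar (P k) (P j) = 0 → ∃ c : ℝ, P j = c • P k := fun j hj hjN h =>
    exists_eq_smul_of_polar_eq_zero (P k) (P j) (hPsym k) (hPsym j) hkdet hktr (hon j hj hjN).1 h
  have hparN : ∀ i ∈ J₀, ∃ c : ℝ, P i = c • P k := fun i hi => ⟨0, by rw [zero_smul]; exact hnode i hi⟩
  set L : Finset (Fin 21) := J'.filter fun j => polar (P k) (P j) ≠ 0 with hL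
  by_cases hLe : L = ∅
  · -- NO-case: the support is parallel to `P k`; with the nodes, ≥ 7 parallel abscissae
    refine false_of_parallel_touches δ hd S hS τ hτ 0 hdet0 (P k) (hPsym k) hkdet hktr (J' ∪ J₀)
      (by rw [Finset.card_union_of_disjoint hJ'N]; omega) ?_
    intro j hj
    rcases Finset.mem_union.1 hj with hj | hj
    · refine hpar j (hJ'J j hj).1 (hJ'J j hj).2 (not_not.1 fun h => ?_)
      have : j ∈ L := Finset.mem_filter.2 ⟨hj, h⟩
      rw [hLe] at this; exact Finset.notMem_empty _ this
    · exact hparN j hj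
  · have hLne : L.Nonempty := Finset.nonempty_iff_ne_empty.2 hLe
    set l := L.max' hLne with hl
    have hlL : l ∈ L := Finset.max'_mem _ _
    have hlJ' : l ∈ J' := (Finset.mem_filter.1 hlL).1
    have hkl : polar (P k) (P l) ≠ 0 := (Finset.mem_filter.1 hlL).2
    obtain ⟨hldet, hltr⟩ := hon l (hJ'J l hlJ').1 (hJ'J l hlJ').2
    have hlk : l < k := by
      refine lt_of_le_of_ne (hle_k l hlJ') fun h => hkl ?_
      rw [h, polar_self]; exact hkdet
    set X : Matrix (Fin 2) (Fin 2) ℝ := !![2 * ((P k) 0 0 * (P l) 0 1 - (P k) 0 1 * (P l) 0 0),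
        (P k) 0 0 * (P l) 1 1 - (P k) 1 1 * (P l) 0 0; (P k) 0 0 * (P l) 1 1 - (P k) 1 1 * (P l) 0 0,
        2 * ((P k) 0 1 * (P l) 1 1 - (P k) 1 1 * (P l) 0 1)] with hX
    obtain ⟨hXk, hXl⟩ := polar_cross_left_right (P k) (P l) (hPsym k) (hPsym l)
    by_cases hzero : ∀ j, μ j * κ j * polar X (P j) = 0
    · set A' : Finset (Fin 21) := J'.filter fun j => polar (P k) (P j) = 0 with hA'
      have hkA' : k ∈ A' := Finset.mem_filter.2 ⟨hkJ', by rw [polar_self]; exact hkdet⟩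
      have hA'N : Disjoint A' J₀ := Finset.disjoint_left.2 fun j hj h => (hJ'J j (Finset.mem_filter.1 hj).1).2 h
      have hsuppl : ∀ j ∉ A', μ j * κ j * polar (P l) (P j) = 0 := by
        intro j hj
        by_cases hjJ' : j ∈ J'
        · have hXj : polar X (P j) = 0 := by
            have := hzero j
            rcases mul_eq_zero.1 this with h | h
            · rcases mul_eq_zero.1 h with h' | h'
              · exact absurd h' ((hmemJ' j).1 hjJ')
              · exact absurd h' (hκ j)
            · exact h
          have hjk : polar (P k) (P j) ≠ 0 := fun h => hj (Finset.mem_filter.2 ⟨hjJ', h⟩)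
          rcases polar_eq_zero_or_of_cross (P k) (P l) (P j) (hPsym k) (hPsym l) (hPsym j) hkdet hldet
            (hon j (hJ'J j hjJ').1 (hJ'J j hjJ').2).1 hkl hXj with h | h
          · rw [h, mul_zero]
          · exact absurd (by rw [polar_comm]; exact h) hjk
        · rw [not_not.1 fun h => hjJ' ((hmemJ' j).2 h)]; ring
      by_cases hA'card : A'.card + J₀.card ≤ 6
      · have hz := eq_zero_of_pairing_small δ hd τ hτ A' J₀ hA'N hA'card
          (fun j => μ j * κ j * polar (P l) (P j)) hsuppl (hker (P l)) k
        rcases mul_eq_zero.1 hz with h | h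
        · rcases mul_eq_zero.1 h with h' | h'
          · exact (hmemJ' k).1 hkJ' h'
          · exact hκ k h'
        · exact hkl (by rw [polar_comm]; exact h)
      · refine false_of_parallel_touches δ hd S hS τ hτ 0 hdet0 (P k) (hPsym k) hkdet hktr (A' ∪ J₀)
          (by rw [Finset.card_union_of_disjoint hA'N]; omega) ?_
        intro j hj
        rcases Finset.mem_union.1 hj with hj | hj
        · obtain ⟨hjJ', hjk⟩ := Finset.mem_filter.1 hj
          exact hpar j (hJ'J j hjJ').1 (hJ'J j hjJ').2 hjk
        · exact hparN j hj
    · push Not at hzero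
      refine false_of_short_restricted δ hd S τ hτ κ halt J J₀ hJ₀ h0 h20 hsep ?_ hnode μ hμ0 X l k hlk
        (hJ'J l hlJ').2 (hJ'J k hkJ').2 hXl hXk (fun c hc => hker X c hc) ?_ hzero
      · -- `|J| ≥ 9`
        set A : Finset (Fin 21) := Finset.univ.filter fun j => μ j * κ j * polar X (P j) ≠ 0 with hA
        have hAsub : ∀ j ∈ A, j ∈ J' ∧ j ≠ l ∧ j ≠ k := by
          intro j hj
          have hj' := (Finset.mem_filter.1 hj).2
          refine ⟨(hmemJ' j).2 fun h => hj' (by rw [h]; ring), fun h => hj' ?_, fun h => hj' ?_⟩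
          · rw [h, hXl, mul_zero]
          · rw [h, hXk, mul_zero]
        have hAN : Disjoint A J₀ := Finset.disjoint_left.2 fun j hj h => (hJ'J j (hAsub j hj).1).2 h
        have hA7 : 7 ≤ A.card + J₀.card := by
          by_contra hlt
          obtain ⟨j, hj⟩ := hzero
          have := eq_zero_of_pairing_small δ hd τ hτ A J₀ hAN (by omega)
            (fun j => μ j * κ j * polar X (P j)) (fun j hj => not_not.1 fun h =>
              hj (Finset.mem_filter.2 ⟨Finset.mem_univ _, h⟩)) (hker X) j
          exact hj this
        have hsub : insert l (insert k (A ∪ J₀)) ⊆ J := by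
          intro j hj
          rcases Finset.mem_insert.1 hj with rfl | hj
          · exact (hJ'J _ hlJ').1
          rcases Finset.mem_insert.1 hj with rfl | hj
          · exact (hJ'J _ hkJ').1
          rcases Finset.mem_union.1 hj with hj | hj
          · exact (hJ'J _ (hAsub j hj).1).1
          · exact hJ₀ hj
        have hcard : (insert l (insert k (A ∪ J₀))).card = A.card + J₀.card + 2 := by
          rw [Finset.card_insert_of_notMem, Finset.card_insert_of_notMem, Finset.card_union_of_disjoint hAN]
          · intro h
            rcases Finset.mem_union.1 h with h | h
            · exact (hAsub k h).2.2 rfl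
            · exact (hJ'J k hkJ').2 h
          · rw [Finset.mem_insert, not_or]
            refine ⟨ne_of_lt hlk, fun h => ?_⟩
            rcases Finset.mem_union.1 h with h | h
            · exact (hAsub l h).2.1 rfl
            · exact (hJ'J l hlJ').2 h
        have := Finset.card_le_card hsub
        omega
      · -- the support lies in `J ∖ J₀`, before `l`
        intro j hj
        change μ j * κ j * polar X (P j) ≠ 0 at hj
        have hjJ' : j ∈ J' := (hmemJ' j).2 fun h => hj (by rw [h]; ring)
        refine ⟨(hJ'J j hjJ').1, (hJ'J j hjJ').2, ?_⟩
        by_contra hjl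
        rcases lt_or_eq_of_le (not_lt.1 hjl) with hlt | heq
        · rcases lt_or_eq_of_le (hle_k j hjJ') with hjk | hjk
          · have hjL : j ∉ L := fun h => not_le.2 hlt (by rw [hl]; exact Finset.le_max' L j h)
            have hpk : polar (P k) (P j) = 0 := not_not.1 fun h => hjL (Finset.mem_filter.2 ⟨hjJ', h⟩)
            obtain ⟨c, hc⟩ := hpar j (hJ'J j hjJ').1 (hJ'J j hjJ').2 hpk
            exact hj (by rw [hc, polar_smul_right, hXk]; ring)
          · exact hj (by rw [hjk, hXk, mul_zero])
        · exact hj (by rw [← heq, hXl, mul_zero])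

end Summit.ValiantsHypothesis.ValiantsHypothesis.Theorems.LacunarySymmetroidMatrixDescartes.WallBubbling
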